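import Summits.Ventures.PercRepro.ProfileGapMonoThresholdThreeLinesBad

/-!
# PercRepro — LINES OF AT MOST 3 POINTS AT CO-RANK 3, II: THE FLAT-UP RULE (`t + 4 ≤ #E`) (p5, gen 29;
`proofs/P5-GM1.md` §34(2); announced INBOX 13565)

For a bad line `ℓ = cl B` (`#ℓ = 3`, `E ∖ B` independent) and an outside point `x`, the set `ℓ ∪ x` has rank `3`
(`rk_insert_clF_eq_three`) and complement rank `#E − 4 ≥ t` (`insert_clF_mem_levelSetCoQ_three`), and `x` is its
only coloop (`coloops_insert_clF_subset`, `mem_coloops_insert_clF`) — so a target determines its line and its point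
(`eq_of_insert_clF_eq`) and has slack `3 − d_t ≥ 2`.  Two outside points per bad line pay its at most `3` bad sets:
**`card_bad_le_of_add_four_le`**, the demanding bad sets number at most `Σ_{S∈T_t} (3 − d_t(S))`.
-/

open scoped Matroid

namespace PercRepro.Cogirth

open Finset ThmH Skew Shadow Profile

variable {α : Type} [DecidableEq α] {N : Matroid α} [N.Finite]

section FlatUp

variable {t : ℕ}

/-- `ρ(ℓ ∪ x) = 3` for a rank-`2` set `B` with line `ℓ = cl B` and `x ∉ ℓ`. -/
theorem rk_insert_clF_eq_three {B : Finset α} (hB : B ∈ Rq N 2) {x : α} (hx : x ∈ gr N \ clF N B) :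
    rk N (insert x (clF N B)) = 3 := by
  obtain ⟨hBg, hBr⟩ := mem_Rq.1 hB
  have hBrk : rk N B = 2 := rk_eq_of_eRk_eq_cq hBr
  obtain ⟨hxg, hxcl⟩ := mem_sdiff.1 hx
  have h1 : rk N (insert x B) = 3 := by rw [rk_insert_eq hxg hBg, if_neg hxcl, hBrk]
  have h2 : rk N (insert x B) ≤ rk N (insert x (clF N B)) :=
    rk_mono' (insert_subset_insert _ (subset_clF hBg))
  have h3 : rk N (insert x (clF N B)) ≤ rk N (clF N B) + 1 := rk_insert_le _ _
  rw [rk_clF] at h3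
  omega

/-- **A bad line plus an outside point lies in `T_t`** when `t + 4 ≤ #E`: `ρ(ℓ ∪ x) = 3` and
`ρ(E ∖ (ℓ ∪ x)) = ρ((E ∖ ℓ) ∖ x) = #E − 4 ≥ t` (`E ∖ ℓ ⊆ E ∖ B` is independent). -/
theorem insert_clF_mem_levelSetCoQ_three {B : Finset α} (hB : B ∈ Rq N 2)
    (hbad : B.card = 2 ∧ (clF N B).card = 3 ∧ rk N (gr N \ B) = (gr N \ B).card)
    (h4 : t + 4 ≤ (gr N).card) {x : α} (hx : x ∈ gr N \ clF N B) :
    insert x (clF N B) ∈ levelSetCoQ N t 3 := by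
  obtain ⟨hBg, hBr⟩ := mem_Rq.1 hB
  have hBrk : rk N B = 2 := rk_eq_of_eRk_eq_cq hBr
  have hclg : clF N B ⊆ gr N := clF_subset_gr B
  obtain ⟨hxg, hxcl⟩ := mem_sdiff.1 hx
  have hxB : x ∉ B := fun h => hxcl (subset_clF hBg h)
  rw [mem_levelSetCoQ]
  refine ⟨⟨insert_subset hxg hclg, ?_⟩, ?_⟩
  · exact eRk_eq_of_rk_eq_cq (rk_insert_clF_eq_three hB hx)
  · have hsub : gr N \ clF N B ⊆ gr N \ B := sdiff_subset_sdiff (Subset.refl _) (subset_clF hBg)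
    have hind : rk N (gr N \ clF N B) = (gr N \ clF N B).card :=
      rk_eq_card_of_subset_indepFin hsub hbad.2.2
    have heq : gr N \ insert x (clF N B) = (gr N \ clF N B).erase x := by
      ext y
      simp only [mem_sdiff, mem_insert, mem_erase, not_or]
      tauto
    have hind' : rk N ((gr N \ clF N B).erase x) = ((gr N \ clF N B).erase x).card :=
      rk_eq_card_of_subset_indepFin (erase_subset _ _) hind
    rw [heq, hind', card_erase_of_mem hx, card_sdiff_of_subset hclg, hbad.2.1]
    omega

/-- **The coloops of `ℓ ∪ x` are among `{x}`** (simple, `#ℓ = 3`): for `y ∈ ℓ`, `ρ((ℓ ∪ x) ∖ y) ≥ ρ((ℓ ∖ y) ∪ x) = 3`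
by submodularity with `ρ(ℓ ∖ y) = 2`. -/
theorem coloops_insert_clF_subset (hpair : ∀ x ∈ gr N, ∀ y ∈ gr N, x ≠ y → rk N {x, y} = 2)
    {B : Finset α} (hB : B ∈ Rq N 2) (hcl3 : (clF N B).card = 3) {x : α} (hx : x ∈ gr N \ clF N B) :
    coloops N (insert x (clF N B)) ⊆ {x} := by
  obtain ⟨hBg, hBr⟩ := mem_Rq.1 hB
  have hBrk : rk N B = 2 := rk_eq_of_eRk_eq_cq hBr
  have hclg : clF N B ⊆ gr N := clF_subset_gr B
  obtain ⟨hxg, hxcl⟩ := mem_sdiff.1 hx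
  have hS3 : rk N (insert x (clF N B)) = 3 := rk_insert_clF_eq_three hB hx
  intro y hy
  rw [mem_coloops] at hy
  obtain ⟨hyS, hycl⟩ := hy
  rw [mem_singleton]
  by_contra hyx
  have hyl : y ∈ clF N B := by
    rcases mem_insert.1 hyS with h | h
    · exact absurd h hyx
    · exact h
  have hyg : y ∈ gr N := hclg hyl
  -- `ℓ ∖ y` is a pair of distinct points, of rank `2`
  have hc2 : ((clF N B).erase y).card = 2 := by rw [card_erase_of_mem hyl, hcl3]
  obtain ⟨u, v, huv, hpair_eq⟩ := card_eq_two.1 hc2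
  have hu : u ∈ gr N := hclg (mem_of_mem_erase (by rw [hpair_eq]; exact mem_insert_self _ _))
  have hv : v ∈ gr N := hclg (mem_of_mem_erase (by rw [hpair_eq]; exact mem_insert_of_mem (mem_singleton_self _)))
  have hr2 : rk N ((clF N B).erase y) = 2 := by rw [hpair_eq]; exact hpair u hu v hv huv
  -- submodularity: `ρ(ℓ ∪ x) + ρ(ℓ ∖ y) ≤ ρ((ℓ ∖ y) ∪ x) + ρ(ℓ)`
  have hsub := rk_union_add_rk_inter_le (M := N) (insert x ((clF N B).erase y)) (clF N B)
  have hU : insert x ((clF N B).erase y) ∪ clF N B = insert x (clF N B) := by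
    ext z
    simp only [mem_union, mem_insert, mem_erase]
    constructor
    · rintro ((h | ⟨_, h⟩) | h)
      · exact Or.inl h
      · exact Or.inr h
      · exact Or.inr h
    · rintro (h | h)
      · exact Or.inl (Or.inl h)
      · exact Or.inr h
  have hI : insert x ((clF N B).erase y) ∩ clF N B = (clF N B).erase y := by
    ext z
    simp only [mem_inter, mem_insert, mem_erase]
    constructor
    · rintro ⟨h | ⟨hzy, hz⟩, hz'⟩
      · exact absurd (h ▸ hz') hxcl
      · exact ⟨hzy, hz⟩
    · rintro ⟨hzy, hz⟩
      exact ⟨Or.inr ⟨hzy, hz⟩, hz⟩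
  rw [hU, hI, hS3, hr2, rk_clF, hBrk] at hsub
  -- hence `ρ((ℓ ∪ x) ∖ y) = 3 = ρ(ℓ ∪ x)`, so `y ∈ cl((ℓ ∪ x) ∖ y)`
  have hsub' : insert x ((clF N B).erase y) ⊆ (insert x (clF N B)).erase y := by
    intro z hz
    rw [mem_erase, mem_insert]
    rcases mem_insert.1 hz with h | h
    · exact ⟨by rw [h]; exact fun h' => hyx h'.symm, Or.inl h⟩
    · exact ⟨(mem_erase.1 h).1, Or.inr (mem_erase.1 h).2⟩
  have h5 : rk N ((insert x (clF N B)).erase y) ≤ rk N (insert x (clF N B)) := rk_mono' (erase_subset _ _)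
  have h6 : rk N (insert x ((clF N B).erase y)) ≤ rk N ((insert x (clF N B)).erase y) := rk_mono' hsub'
  apply hycl
  rw [mem_clF_iff_rk_insert hyg ((erase_subset _ _).trans (insert_subset hxg hclg)), insert_erase hyS]
  omega

/-- **`x` is a coloop of `ℓ ∪ x`** (`ρ(ℓ) = 2 < 3`). -/
theorem mem_coloops_insert_clF {B : Finset α} (hB : B ∈ Rq N 2) {x : α} (hx : x ∈ gr N \ clF N B) :
    x ∈ coloops N (insert x (clF N B)) := by
  have hS3 : rk N (insert x (clF N B)) = 3 := rk_insert_clF_eq_three hB hx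
  obtain ⟨hBg, hBr⟩ := mem_Rq.1 hB
  have hBrk : rk N B = 2 := rk_eq_of_eRk_eq_cq hBr
  have hclg : clF N B ⊆ gr N := clF_subset_gr B
  obtain ⟨hxg, hxcl⟩ := mem_sdiff.1 hx
  apply mem_coloops_of_rk_erase (insert_subset hxg hclg) (mem_insert_self _ _)
  rw [erase_insert hxcl, rk_clF, hBrk, hS3]

/-- **A target determines its line and its point**: `ℓ ∪ x = ℓ' ∪ x'` with `x ∉ ℓ`, `x' ∉ ℓ'` (bad lines) forces
`x = x'` (the unique coloop) and `ℓ = ℓ'`. -/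
theorem eq_of_insert_clF_eq (hpair : ∀ x ∈ gr N, ∀ y ∈ gr N, x ≠ y → rk N {x, y} = 2)
    {B B' : Finset α} (hB : B ∈ Rq N 2) (hB' : B' ∈ Rq N 2) (hcl3 : (clF N B).card = 3)
    (hcl3' : (clF N B').card = 3) {x x' : α} (hx : x ∈ gr N \ clF N B) (hx' : x' ∈ gr N \ clF N B')
    (heq : insert x (clF N B) = insert x' (clF N B')) : clF N B = clF N B' ∧ x = x' := by
  have hc : coloops N (insert x (clF N B)) = {x} :=
    Subset.antisymm (coloops_insert_clF_subset hpair hB hcl3 hx)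
      (singleton_subset_iff.2 (mem_coloops_insert_clF hB hx))
  have hc' : coloops N (insert x' (clF N B')) = {x'} :=
    Subset.antisymm (coloops_insert_clF_subset hpair hB' hcl3' hx')
      (singleton_subset_iff.2 (mem_coloops_insert_clF hB' hx'))
  have hxx : x = x' := by
    have := hc
    rw [heq, hc'] at this
    exact (singleton_inj.1 this).symm
  refine ⟨?_, hxx⟩
  have h1 : (insert x (clF N B)).erase x = clF N B := erase_insert (mem_sdiff.1 hx).2
  have h2 : (insert x' (clF N B')).erase x' = clF N B' := erase_insert (mem_sdiff.1 hx').2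
  rw [← h1, ← h2, heq, hxx]

/-- **The flat-up rule** (`1 ≤ t`, `t + 4 ≤ #E`): the demanding bad sets number at most the slack
`Σ_{S∈T_t} (3 − d_t(S))` — each bad line `ℓ` carries at most `3` bad sets and owns the two targets `ℓ ∪ x₀`, `ℓ ∪ x₁`
of slack `≥ 2` each. -/
theorem card_bad_le_of_add_four_le (hpair : ∀ x ∈ gr N, ∀ y ∈ gr N, x ≠ y → rk N {x, y} = 2) (ht : 1 ≤ t)
    (h4 : t + 4 ≤ (gr N).card) :
    (((Rq N 2).filter (fun B => t + 1 ≤ rk N (gr N \ B))).filter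
      (fun B => B.card = 2 ∧ (clF N B).card = 3 ∧ rk N (gr N \ B) = (gr N \ B).card)).card ≤
    ∑ S ∈ levelSetCoQ N t 3,
      (3 - ((coloops N S).filter
        (fun y => S.erase y ∈ (Rq N 2).filter (fun B => t + 1 ≤ rk N (gr N \ B)))).card) := by
  set L := (Rq N 2).filter (fun B => t + 1 ≤ rk N (gr N \ B)) with hL
  set BP := L.filter (fun B => B.card = 2 ∧ (clF N B).card = 3 ∧ rk N (gr N \ B) = (gr N \ B).card) with hBP
  set sl : Finset α → ℕ := fun S => 3 - ((coloops N S).filter (fun y => S.erase y ∈ L)).card with hsl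
  have hmem : ∀ B ∈ BP, B ∈ Rq N 2 ∧ t + 1 ≤ rk N (gr N \ B) ∧
      (B.card = 2 ∧ (clF N B).card = 3 ∧ rk N (gr N \ B) = (gr N \ B).card) := by
    intro B hB
    rw [hBP, mem_filter, hL, mem_filter] at hB
    exact ⟨hB.1.1, hB.1.2, hB.2⟩
  rcases BP.eq_empty_or_nonempty with hemp | ⟨B₀, hB₀⟩
  · rw [hemp, card_empty]
    exact Nat.zero_le _
  obtain ⟨a₀, _⟩ : B₀.Nonempty := by
    rw [← card_pos, (hmem B₀ hB₀).2.2.1]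
    norm_num
  haveI : Inhabited α := ⟨a₀⟩
  let pick : Finset α → α := fun X => if h : X.Nonempty then h.choose else default
  have hpick : ∀ X : Finset α, X.Nonempty → pick X ∈ X := by
    intro X h
    simp only [pick, dif_pos h]
    exact h.choose_spec
  let x₀ : Finset α → α := fun ℓ => pick (gr N \ ℓ)
  let x₁ : Finset α → α := fun ℓ => pick ((gr N \ ℓ).erase (x₀ ℓ))
  -- for a bad line both points are outside, and distinct
  have hout : ∀ B ∈ BP, x₀ (clF N B) ∈ gr N \ clF N B ∧ x₁ (clF N B) ∈ gr N \ clF N B ∧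
      x₁ (clF N B) ≠ x₀ (clF N B) := by
    intro B hB
    obtain ⟨_, _, hbad⟩ := hmem B hB
    have hcard : (gr N \ clF N B).card = (gr N).card - 3 := by
      rw [card_sdiff_of_subset (clF_subset_gr B), hbad.2.1]
    have hne : (gr N \ clF N B).Nonempty := by
      rw [← card_pos, hcard]
      omega
    have h0 := hpick _ hne
    have hne' : ((gr N \ clF N B).erase (x₀ (clF N B))).Nonempty := by
      rw [← card_pos, card_erase_of_mem h0, hcard]
      omega
    have h1 := hpick _ hne'
    exact ⟨h0, mem_of_mem_erase h1, (mem_erase.1 h1).1⟩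
  let tgt : Finset α → Finset (Finset α) := fun ℓ => {insert (x₀ ℓ) ℓ, insert (x₁ ℓ) ℓ}
  have hdistinct : ∀ B ∈ BP, insert (x₀ (clF N B)) (clF N B) ≠ insert (x₁ (clF N B)) (clF N B) := by
    intro B hB h
    obtain ⟨h0, h1, hne⟩ := hout B hB
    obtain ⟨hBq, _, hbad⟩ := hmem B hB
    exact hne (eq_of_insert_clF_eq hpair hBq hBq hbad.2.1 hbad.2.1 h0 h1 h).2.symm
  have hT : ∀ B ∈ BP, ∀ x ∈ gr N \ clF N B, insert x (clF N B) ∈ levelSetCoQ N t 3 :=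
    fun B hB x hx => insert_clF_mem_levelSetCoQ_three (hmem B hB).1 (hmem B hB).2.2 h4 hx
  have hslack : ∀ B ∈ BP, ∀ x ∈ gr N \ clF N B, 2 ≤ sl (insert x (clF N B)) := by
    intro B hB x hx
    obtain ⟨hBq, _, hbad⟩ := hmem B hB
    have hc := card_le_card (coloops_insert_clF_subset hpair hBq hbad.2.1 hx)
    rw [card_singleton] at hc
    have hf := card_le_card (filter_subset (fun y => (insert x (clF N B)).erase y ∈ L)
      (coloops N (insert x (clF N B))))
    simp only [hsl]
    omega
  -- a target determines its bad line
  have hkey : ∀ B ∈ BP, ∀ B' ∈ BP, ∀ S ∈ tgt (clF N B), S ∈ tgt (clF N B') → clF N B = clF N B' := by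
    intro B hB B' hB' S hS hS'
    obtain ⟨hBq, _, hbad⟩ := hmem B hB
    obtain ⟨hBq', _, hbad'⟩ := hmem B' hB'
    have hx : ∃ x ∈ gr N \ clF N B, S = insert x (clF N B) := by
      rcases mem_insert.1 hS with h | h
      · exact ⟨_, (hout B hB).1, h⟩
      · exact ⟨_, (hout B hB).2.1, mem_singleton.1 h⟩
    have hx' : ∃ x' ∈ gr N \ clF N B', S = insert x' (clF N B') := by
      rcases mem_insert.1 hS' with h | h
      · exact ⟨_, (hout B' hB').1, h⟩
      · exact ⟨_, (hout B' hB').2.1, mem_singleton.1 h⟩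
    obtain ⟨x, hx, rfl⟩ := hx
    obtain ⟨x', hx', heq⟩ := hx'
    exact (eq_of_insert_clF_eq hpair hBq hBq' hbad.2.1 hbad'.2.1 hx hx' heq).1
  set BL := BP.image (clF N) with hBL
  have hfib : ∀ ℓ ∈ BL, (BP.filter (fun B => clF N B = ℓ)).card ≤ 3 := by
    intro ℓ hℓ
    obtain ⟨B₁, hB₁, rfl⟩ := mem_image.1 hℓ
    have h3 : (clF N B₁).card = 3 := (hmem B₁ hB₁).2.2.2.1
    calc (BP.filter (fun B => clF N B = clF N B₁)).card ≤ (powersetCard 2 (clF N B₁)).card := by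
          apply card_le_card
          intro B hB
          rw [mem_filter] at hB
          rw [mem_powersetCard]
          refine ⟨?_, (hmem B hB.1).2.2.1⟩
          rw [← hB.2]
          exact subset_clF (mem_Rq.1 (hmem B hB.1).1).1
      _ = 3 := by rw [card_powersetCard, h3]; rfl
  have hdisj : (BL : Set (Finset α)).PairwiseDisjoint tgt := by
    intro ℓ hℓ ℓ' hℓ' hne
    rw [Finset.mem_coe] at hℓ hℓ'
    obtain ⟨B₁, hB₁, rfl⟩ := mem_image.1 hℓ
    obtain ⟨B₂, hB₂, rfl⟩ := mem_image.1 hℓ'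
    rw [Function.onFun, Finset.disjoint_left]
    intro S hS hS'
    exact hne (hkey B₁ hB₁ B₂ hB₂ S hS hS')
  calc BP.card = ∑ ℓ ∈ BL, (BP.filter (fun B => clF N B = ℓ)).card :=
        card_eq_sum_card_fiberwise (fun B hB => mem_image_of_mem _ hB)
    _ ≤ ∑ _ℓ ∈ BL, 3 := sum_le_sum hfib
    _ ≤ ∑ ℓ ∈ BL, ∑ S ∈ tgt ℓ, sl S := by
        apply sum_le_sum
        intro ℓ hℓ
        obtain ⟨B₁, hB₁, rfl⟩ := mem_image.1 hℓ
        rw [sum_pair (hdistinct B₁ hB₁)]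
        have h0 := hslack B₁ hB₁ _ (hout B₁ hB₁).1
        have h1 := hslack B₁ hB₁ _ (hout B₁ hB₁).2.1
        omega
    _ = ∑ S ∈ BL.biUnion tgt, sl S := by rw [sum_biUnion hdisj]
    _ ≤ ∑ S ∈ levelSetCoQ N t 3, sl S := by
        apply sum_le_sum_of_subset_of_nonneg
        · intro S hS
          rw [mem_biUnion] at hS
          obtain ⟨ℓ, hℓ, hS⟩ := hS
          obtain ⟨B₁, hB₁, rfl⟩ := mem_image.1 hℓ
          rcases mem_insert.1 hS with h | h
          · rw [h]; exact hT B₁ hB₁ _ (hout B₁ hB₁).1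
          · rw [mem_singleton.1 h]; exact hT B₁ hB₁ _ (hout B₁ hB₁).2.1
        · intro _ _ _
          exact Nat.zero_le _

end FlatUp

end PercRepro.Cogirth
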